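import Mathlib
import Literature.NumberTheory.Transcendental.KZCalculus
import Literature.NumberTheory.Transcendental.SemialgebraicMapsProofs
import Literature.NumberTheory.Transcendental.SemialgebraicMonotonicityProofs
import Literature.NumberTheory.Transcendental.SemialgebraicAlgebraicPoints
import Literature.NumberTheory.Transcendental.EllIterRepShuffle
import Literature.NumberTheory.Transcendental.KZLogCalculusProofs
import Summits.KontsevichZagierPeriods.KontsevichZagierPeriods.Theorems.HyperbolicBlochOffTetraSectorKernelRungZeroLogRelations
import Summits.KontsevichZagierPeriods.KontsevichZagierPeriods.Theorems.TorsionLogsNeronTorsionSectorStubDlogUnfoldAux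
import HarnessLib

/-!
# Stub `stub_dlogUnfold` — crux `TorsionLogs.NeronTorsionSector`, line `registered` (block S6), II:
# `∫ dlog G` unfolds into interval logarithms

For real-algebraic `a < b` and a function `G > 0`, continuous and `ℚ`-semialgebraic on `[a, b]`,
with a `ℚ`-semialgebraic derivative `G′` on `(a, b)`, every Kontsevich–Zagier representation
`r = [(a, b), G′/G dx]` is KZ-equivalent (`KZ.relations`) to a `ℤ`-combination
`Σ εᵢ [(αᵢ, βᵢ), dt/t]` of INTERVAL LOG CARRIERS with real-algebraic `0 < αᵢ ≤ βᵢ` and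
`Σ εᵢ log (βᵢ/αᵢ) = log (G b / G a)` — the input format of the landed log calculus
`interval_log_relation_mem_relations`.

Proof (the cell-by-cell change of variables of van den Dries' monotonicity cells, here for the
zero set of `G′`): by `exists_dlog_breakpoints` (file `…StubDlogUnfoldAux.lean`) finitely many
algebraic breakpoints cut `(a, b)` into cells on which `G′ ≡ 0` (the piece is the relation
`[cell, 0]`, and `G` is constant there) or `G′ ≠ 0` (one rule-(2) move `t = G(x)` onto
`±[(G u, G v)^±, dt/t]`, `dlog_cell_cov`); the pieces are reassembled by rule (1a) modulo the null
breakpoints (`dlog_unfold_aux`, induction on the number of breakpoints inside the interval, the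
values telescoping to `log (G b / G a)`).

References: M. Kontsevich, D. Zagier, *Periods* (2001), §1.2 rules (1), (2); L. van den Dries,
*Tame Topology and O-minimal Structures* (1998), Ch. 3 (1.2).
-/

noncomputable section

-- `Summit.KontsevichZagierPeriods.KontsevichZagierPeriods.…` is the tree's mandated layout (single-conjunct summit).
set_option linter.dupNamespace false

open Set MeasureTheory Filter Topology
open Literature.NumberTheory.Transcendental Literature.ModelTheory.ExponentialFields
open Summit.KontsevichZagierPeriods.HyperbolicBloch.OffTetraSectorKernel (isSemialgebraic_logIvl
  ladderTransfer_of_sub_two_mem_relations)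

namespace Summit.KontsevichZagierPeriods.KontsevichZagierPeriods.Cruxes.NeronTorsionSector.Translation

/-! ### Bookkeeping of `Fin`-indexed families of carriers -/

/-- **Concatenation of two families of carriers.** If `X₁` unfolds into a family with values
summing to `L₁` and `X₂` into one with values summing to `L₂` (all carriers satisfying a
property `P`), then `X₁ + X₂` unfolds into the concatenated family (`Fin.append`), with values
summing to `L₁ + L₂`. [folklore] -/
theorem dlog_good_append (P : ℝ → ℝ → KZ.IntegralRep 1 → Prop) {L₁ L₂ : ℝ} {X₁ X₂ : KZ.FormalRep}
    (h₁ : ∃ (κ : ℕ) (α β : Fin κ → ℝ) (ε : Fin κ → ℤ) (c : Fin κ → KZ.IntegralRep 1),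
      (∀ i, P (α i) (β i) (c i)) ∧ ∑ i, (ε i : ℝ) * Real.log (β i / α i) = L₁ ∧
        X₁ - ∑ i, ε i • KZ.of (c i) ∈ KZ.relations)
    (h₂ : ∃ (κ : ℕ) (α β : Fin κ → ℝ) (ε : Fin κ → ℤ) (c : Fin κ → KZ.IntegralRep 1),
      (∀ i, P (α i) (β i) (c i)) ∧ ∑ i, (ε i : ℝ) * Real.log (β i / α i) = L₂ ∧
        X₂ - ∑ i, ε i • KZ.of (c i) ∈ KZ.relations) :
    ∃ (κ : ℕ) (α β : Fin κ → ℝ) (ε : Fin κ → ℤ) (c : Fin κ → KZ.IntegralRep 1),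
      (∀ i, P (α i) (β i) (c i)) ∧ ∑ i, (ε i : ℝ) * Real.log (β i / α i) = L₁ + L₂ ∧
        X₁ + X₂ - ∑ i, ε i • KZ.of (c i) ∈ KZ.relations := by
  obtain ⟨κ₁, α₁, β₁, ε₁, c₁, hP₁, hL₁, hX₁⟩ := h₁
  obtain ⟨κ₂, α₂, β₂, ε₂, c₂, hP₂, hL₂, hX₂⟩ := h₂
  refine ⟨κ₁ + κ₂, Fin.append α₁ α₂, Fin.append β₁ β₂, Fin.append ε₁ ε₂, Fin.append c₁ c₂,
    fun i => ?_, ?_, ?_⟩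
  · induction i using Fin.addCases with
    | left i => simpa only [Fin.append_left] using hP₁ i
    | right i => simpa only [Fin.append_right] using hP₂ i
  · rw [Fin.sum_univ_add]
    simp only [Fin.append_left, Fin.append_right, hL₁, hL₂]
  · rw [Fin.sum_univ_add]
    simp only [Fin.append_left, Fin.append_right]
    have e : X₁ + X₂ - (∑ i, ε₁ i • KZ.of (c₁ i) + ∑ i, ε₂ i • KZ.of (c₂ i)) =
        (X₁ - ∑ i, ε₁ i • KZ.of (c₁ i)) + (X₂ - ∑ i, ε₂ i • KZ.of (c₂ i)) := by abel
    rw [e]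
    exact KZ.relations.add_mem hX₁ hX₂

/-! ### One cell -/

/-- **One cell.** On a cell `(u, v)` (`a ≤ u < v ≤ b`, `u`, `v` algebraic) on which `G′ ≡ 0` or
`G′ ≠ 0`, the representation `[(u, v), G′/G]` unfolds: in the first case into the EMPTY family
(the representation has zero integrand, and `G v = G u`), in the second into the single carrier of
`dlog_cell_cov`. [cite: KontsevichZagier2001, §1.2 rules (1),(2)] -/
theorem dlog_cell {a b u v : ℝ} {G G' : ℝ → ℝ} (r₀ : KZ.IntegralRep 1)
    (hau : a ≤ u) (huv : u < v) (hvb : v ≤ b) (hu : IsAlgebraic ℚ u) (hv : IsAlgebraic ℚ v)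
    (hGpos : ∀ x ∈ Icc a b, 0 < G x) (hGc : ContinuousOn G (Icc a b))
    (hd : ∀ x ∈ Ioo a b, HasDerivAt G (G' x) x)
    (hG : IsSemialgebraicFunOn ℚ {t : Fin 1 → ℝ | t 0 ∈ Icc a b} (fun t => G (t 0)))
    (hcell : (∀ x ∈ Ioo u v, G' x = 0) ∨ (∀ x ∈ Ioo u v, G' x ≠ 0))
    (hdom : r₀.domain = {t | u < t 0 ∧ t 0 < v})
    (hint : EqOn r₀.integrand (fun t => G' (t 0) / G (t 0)) r₀.domain) :
    ∃ (κ : ℕ) (α β : Fin κ → ℝ) (ε : Fin κ → ℤ) (c : Fin κ → KZ.IntegralRep 1),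
      (∀ i, 0 < α i ∧ α i ≤ β i ∧ IsAlgebraic ℚ (α i) ∧ IsAlgebraic ℚ (β i) ∧
        (c i).domain = {t | α i < t 0 ∧ t 0 < β i} ∧
        EqOn (c i).integrand (fun t => 1 / t 0) (c i).domain) ∧
      ∑ i, (ε i : ℝ) * Real.log (β i / α i) = Real.log (G v / G u) ∧
      KZ.of r₀ - ∑ i, ε i • KZ.of (c i) ∈ KZ.relations := by
  rcases hcell with h0 | hne
  · -- `G′ ≡ 0`: the empty family
    have hIoo : Ioo u v ⊆ Ioo a b := Ioo_subset_Ioo hau hvb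
    have hGvu : G v = G u := dlog_cell_const huv (hGc.mono (Icc_subset_Icc hau hvb))
      (fun x hx => hd x (hIoo hx)) h0
    have hGu : 0 < G u := hGpos u ⟨hau, huv.le.trans hvb⟩
    have hr₀ : KZ.of r₀ ∈ KZ.relations := KZ.of_mem_relations_of_eqOn_zero r₀ fun p hp => by
      have hp' : p 0 ∈ Ioo u v := by rw [hdom] at hp; exact hp
      rw [hint hp, Pi.zero_apply]
      show G' (p 0) / G (p 0) = 0
      rw [h0 _ hp', zero_div]
    refine ⟨0, Fin.elim0, Fin.elim0, Fin.elim0, Fin.elim0, fun i => i.elim0, ?_, ?_⟩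
    · simp [hGvu, div_self hGu.ne']
    · simpa using hr₀
  · -- `G′ ≠ 0`: one carrier
    obtain ⟨α, β, ε, c, hα, hαβ, hαa, hβa, hcd, hci, hlog, hrel⟩ :=
      dlog_cell_cov r₀ hau huv hvb hu hv hGpos hGc hd hG hne hdom hint
    refine ⟨1, fun _ => α, fun _ => β, fun _ => ε, fun _ => c,
      fun _ => ⟨hα, hαβ, hαa, hβa, hcd, hci⟩, ?_, ?_⟩
    · rw [Fin.sum_univ_one]
      exact hlog
    · rw [Fin.sum_univ_one]
      exact hrel

/-! ### Induction on the number of breakpoints -/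

/-- **Unfolding `[(u, v), G′/G]` by induction on the number of breakpoints inside `(u, v)`.**
Given a finite set `S` of algebraic breakpoints off which `G′ ≡ 0` or `G′ ≠ 0` on intervals
(`exists_dlog_breakpoints`): with no breakpoint inside, `(u, v)` is one cell (`dlog_cell`);
otherwise split at a breakpoint `m` — `[(u,v)] − [(u,m)] − [(m,v)]` is a relation (rule (1a)
modulo the null point `{t = m}`), both halves have fewer breakpoints, the two families are
concatenated and `log (G m/G u) + log (G v/G m) = log (G v/G u)`.
[cite: KontsevichZagier2001, §1.2 rules (1),(2)] -/
theorem dlog_unfold_aux {a b : ℝ} {G G' : ℝ → ℝ} (S : Finset ℝ)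
    (hSalg : ∀ x ∈ S, IsAlgebraic ℚ x)
    (hS : ∀ u v : ℝ, Ioo u v ⊆ Ioo a b → (∀ x ∈ S, x ∉ Ioo u v) →
      (∀ x ∈ Ioo u v, G' x = 0) ∨ (∀ x ∈ Ioo u v, G' x ≠ 0))
    (hGpos : ∀ x ∈ Icc a b, 0 < G x) (hGc : ContinuousOn G (Icc a b))
    (hd : ∀ x ∈ Ioo a b, HasDerivAt G (G' x) x)
    (hG : IsSemialgebraicFunOn ℚ {t : Fin 1 → ℝ | t 0 ∈ Icc a b} (fun t => G (t 0))) (n : ℕ) :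
    ∀ (u v : ℝ) (r₀ : KZ.IntegralRep 1), (S.filter fun x => u < x ∧ x < v).card = n →
      a ≤ u → u < v → v ≤ b → IsAlgebraic ℚ u → IsAlgebraic ℚ v →
      r₀.domain = {t | u < t 0 ∧ t 0 < v} →
      EqOn r₀.integrand (fun t => G' (t 0) / G (t 0)) r₀.domain →
      ∃ (κ : ℕ) (α β : Fin κ → ℝ) (ε : Fin κ → ℤ) (c : Fin κ → KZ.IntegralRep 1),
        (∀ i, 0 < α i ∧ α i ≤ β i ∧ IsAlgebraic ℚ (α i) ∧ IsAlgebraic ℚ (β i) ∧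
          (c i).domain = {t | α i < t 0 ∧ t 0 < β i} ∧
          EqOn (c i).integrand (fun t => 1 / t 0) (c i).domain) ∧
        ∑ i, (ε i : ℝ) * Real.log (β i / α i) = Real.log (G v / G u) ∧
        KZ.of r₀ - ∑ i, ε i • KZ.of (c i) ∈ KZ.relations := by
  induction n using Nat.strong_induction_on with
  | _ n ih =>
  intro u v r₀ hcard hau huv hvb hu hv hdom hint
  by_cases hT : (S.filter fun x => u < x ∧ x < v) = ∅
  · -- no breakpoint inside: one cell
    refine dlog_cell r₀ hau huv hvb hu hv hGpos hGc hd hG (hS u v (Ioo_subset_Ioo hau hvb) ?_)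
      hdom hint
    intro x hx hxI
    have h : x ∈ S.filter fun x => u < x ∧ x < v := Finset.mem_filter.2 ⟨hx, hxI⟩
    rw [hT] at h
    exact Finset.notMem_empty x h
  · -- split at a breakpoint `m ∈ (u, v)`
    obtain ⟨m, hm⟩ := Finset.nonempty_iff_ne_empty.2 hT
    obtain ⟨hmS, hum, hmv⟩ := Finset.mem_filter.1 hm
    have hmalg : IsAlgebraic ℚ m := hSalg m hmS
    have ham : a ≤ m := hau.trans hum.le
    have hmb : m ≤ b := hmv.le.trans hvb
    have hs₁ : {t : Fin 1 → ℝ | u < t 0 ∧ t 0 < m} ⊆ r₀.domain := by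
      rw [hdom]
      exact fun t ht => ⟨ht.1, ht.2.trans hmv⟩
    have hs₂ : {t : Fin 1 → ℝ | m < t 0 ∧ t 0 < v} ⊆ r₀.domain := by
      rw [hdom]
      exact fun t ht => ⟨hum.trans ht.1, ht.2⟩
    set r₁ := r₀.restrict _ (isSemialgebraic_logIvl hu hmalg) hs₁ with hr₁
    set r₂ := r₀.restrict _ (isSemialgebraic_logIvl hmalg hv) hs₂ with hr₂
    -- fewer breakpoints in each half
    have hlt₁ : (S.filter fun x => u < x ∧ x < m).card < n := by
      rw [← hcard]
      refine Finset.card_lt_card ⟨fun x hx => ?_, fun h => ?_⟩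
      · obtain ⟨hxS, hux, hxm⟩ := Finset.mem_filter.1 hx
        exact Finset.mem_filter.2 ⟨hxS, hux, hxm.trans hmv⟩
      · exact lt_irrefl m (Finset.mem_filter.1 (h hm)).2.2
    have hlt₂ : (S.filter fun x => m < x ∧ x < v).card < n := by
      rw [← hcard]
      refine Finset.card_lt_card ⟨fun x hx => ?_, fun h => ?_⟩
      · obtain ⟨hxS, hmx, hxv⟩ := Finset.mem_filter.1 hx
        exact Finset.mem_filter.2 ⟨hxS, hum.trans hmx, hxv⟩
      · exact lt_irrefl m (Finset.mem_filter.1 (h hm)).2.1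
    have h₁ := ih _ hlt₁ u m r₁ rfl hau hum hmb hu hmalg rfl fun p hp => hint (hs₁ hp)
    have h₂ := ih _ hlt₂ m v r₂ rfl ham hmv hvb hmalg hv rfl fun p hp => hint (hs₂ hp)
    obtain ⟨κ, α, β, ε, c, hP, hL, hX⟩ := dlog_good_append
      (fun α β c => 0 < α ∧ α ≤ β ∧ IsAlgebraic ℚ α ∧ IsAlgebraic ℚ β ∧
        c.domain = {t | α < t 0 ∧ t 0 < β} ∧ EqOn c.integrand (fun t => 1 / t 0) c.domain) h₁ h₂
    refine ⟨κ, α, β, ε, c, hP, ?_, ?_⟩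
    · -- the values telescope
      have hGu : 0 < G u := hGpos u ⟨hau, huv.le.trans hvb⟩
      have hGm : 0 < G m := hGpos m ⟨ham, hmb⟩
      have hGv : 0 < G v := hGpos v ⟨hau.trans huv.le, hvb⟩
      rw [hL, Real.log_div hGm.ne' hGu.ne', Real.log_div hGv.ne' hGm.ne',
        Real.log_div hGv.ne' hGu.ne']
      ring
    · -- `[r₀] − [r₁] − [r₂]` is a relation: rule (1a) modulo the null point `{t = m}`
      have hsplit : KZ.of r₀ - KZ.of r₁ - KZ.of r₂ ∈ KZ.relations := by
        refine ladderTransfer_of_sub_two_mem_relations r₀ r₁ r₂ hs₁ hs₂ (fun _ _ => rfl)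
          (fun _ _ => rfl) ?_ ?_
        · have h : r₁.domain ∩ r₂.domain = ∅ := by
            rw [hr₁, hr₂, KZ.IntegralRep.domain_restrict, KZ.IntegralRep.domain_restrict]
            ext p
            simp only [mem_inter_iff, mem_setOf_eq, mem_empty_iff_false, iff_false, not_and,
              not_lt, and_imp]
            intro _ h2 h3
            linarith
          rw [h, measure_empty]
        · refine measure_mono_null (fun p hp => ?_) (KZ.volume_setOf_last_eq_zero (n := 0) m)
          rw [hdom, hr₁, hr₂, KZ.IntegralRep.domain_restrict, KZ.IntegralRep.domain_restrict] at hp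
          simp only [Set.mem_sdiff, mem_setOf_eq, mem_union, not_or, not_and, not_lt] at hp
          obtain ⟨⟨h1, h2⟩, h3, h4⟩ := hp
          show p 0 = m
          rcases (h3 h1).lt_or_eq with h5 | h5
          · exact absurd h2 (not_lt.2 (h4 h5))
          · exact h5.symm
      have e : KZ.of r₀ - ∑ i, ε i • KZ.of (c i) =
          (KZ.of r₀ - KZ.of r₁ - KZ.of r₂) + (KZ.of r₁ + KZ.of r₂ - ∑ i, ε i • KZ.of (c i)) := by
        abel
      rw [e]
      exact KZ.relations.add_mem hsplit hX

/-! ### The stub -/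

/-- **STUB S6 (`stub_dlogUnfold`) — `∫ dlog` of a positive `ℚ`-semialgebraic function unfolds
into interval logarithms.** For algebraic `a < b`, `G > 0` continuous on `[a, b]` with derivative `G′` on
`(a, b)`, `G` (on the closed interval) and `G′` `ℚ`-semialgebraic, a representation
`r = [(a,b), G′/G]` is KZ-equivalent to a `ℤ`-combination of interval log carriers `[(αᵢ, βᵢ), dt/t]`
(`0 < αᵢ ≤ βᵢ` algebraic) whose values add up to `log(G b / G a)`. Proof: the zero set of the
`ℚ`-semialgebraic `G′` has finitely many algebraic breakpoints off which, on intervals, `G′ ≡ 0` or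
`G′ ≠ 0` (`exists_dlog_breakpoints`, o-minimality); on a cell either `G′ ≡ 0` (contributes `0`) or
`G′` has one sign (Darboux), `G` is strictly monotone and rule (2) with `t = G(x)` maps the cell onto
`(G(u), G(v))^±` with integrand `1/t` (`dlog_cell_cov`); the cells are reassembled by rule (1a)
(`dlog_unfold_aux`). [cite: Dries1998, Ch. 3 (1.2)] [cite: KontsevichZagier2001, §1.2 rules (1),(2)] -/
theorem stub_dlogUnfold :
    ∀ (a b : ℝ) (G G' : ℝ → ℝ) (r : Literature.NumberTheory.Transcendental.KZ.IntegralRep 1),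
    a < b → IsAlgebraic ℚ a → IsAlgebraic ℚ b →
    (∀ x ∈ Set.Icc a b, 0 < G x) → ContinuousOn G (Set.Icc a b) →
    (∀ x ∈ Set.Ioo a b, HasDerivAt G (G' x) x) →
    IsSemialgebraicFunOn ℚ {t : Fin 1 → ℝ | t 0 ∈ Set.Icc a b} (fun t => G (t 0)) →
    IsSemialgebraicFunOn ℚ {t : Fin 1 → ℝ | t 0 ∈ Set.Ioo a b} (fun t => G' (t 0)) →
    r.domain = {t | a < t 0 ∧ t 0 < b} →
    Set.EqOn r.integrand (fun t => G' (t 0) / G (t 0)) r.domain →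
    ∃ (κ : ℕ) (α β : Fin κ → ℝ) (ε : Fin κ → ℤ)
      (c : Fin κ → Literature.NumberTheory.Transcendental.KZ.IntegralRep 1),
      (∀ i, 0 < α i ∧ α i ≤ β i ∧ IsAlgebraic ℚ (α i) ∧ IsAlgebraic ℚ (β i) ∧
        (c i).domain = {t | α i < t 0 ∧ t 0 < β i} ∧
        Set.EqOn (c i).integrand (fun t => 1 / t 0) (c i).domain) ∧
      ∑ i, (ε i : ℝ) * Real.log (β i / α i) = Real.log (G b / G a) ∧
      Literature.NumberTheory.Transcendental.KZ.of r - ∑ i, ε i • Literature.NumberTheory.Transcendental.KZ.of (c i) ∈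
        Literature.NumberTheory.Transcendental.KZ.relations := by
  intro a b G G' r hab ha hb hGpos hGc hd hG hG' hdom hint
  obtain ⟨S, hSalg, hS⟩ := exists_dlog_breakpoints hG'
  exact dlog_unfold_aux S hSalg hS hGpos hGc hd hG _ a b r rfl le_rfl hab le_rfl ha hb hdom hint

end Summit.KontsevichZagierPeriods.KontsevichZagierPeriods.Cruxes.NeronTorsionSector.Translation

end
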